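import Mathlib
import Literature.Analysis.FluidPDE.PineauVicolPressureDecayClass

/-!
# Route PlaneEnergyCeiling · crux `PlanarEnergyAPriori` — decay persistence, pressure part (1):
# the source `∂ᵢ∂ⱼ(wᵢwⱼ)` of the pressure Poisson equation under cubic decay, and weight algebra

Helper file for the crux item stmt-NavierStokesRegularity-16855 (`PlanarEnergyAPriori`, route
`PlaneEnergyCeiling`), landed `--supports` that item, on the proof path of the registered stub
`stub_decayPersistence` of the line `birth` (the pressure clauses
`(1 + |x|)² (|p - π₀(s)| + |∇p|) ≤ C₀`). For a divergence-free field `w ∈ C³(ℝ³; ℝ³)` whose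
derivatives of orders `≤ 3` carry the cubic weight, `(1 + |y|)³ ‖Dᵏw(y)‖ ≤ C`, the normalised
pressure `p̃[w] = -Δ⁻¹∂ᵢ∂ⱼ(wᵢwⱼ)` (tree: `normalisedPressure`, realised through the pressure
potential `Q[w] = -Q₁[w] - Q₂[w]` of `PressureRepresentation`) satisfies

  `(1 + |x|)² (|p̃[w](x)| + ‖∇p̃[w](x)‖) ≤ K C²`   (`exists_decay_normalisedPressure`),

with an absolute constant `K`. Mechanism:
* the source `G[w] = ∂ᵢ∂ⱼ(wᵢwⱼ) = div((w·∇)w)` and its gradient are `O(C² (1+|y|)⁻⁶)`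
  (`abs_pressureSource_le_of_decay`, `norm_fderiv_pressureSource_le_of_decay`: trace bound
  `|div f| ≤ 3‖Df‖`, product rule for `(w·∇)w = Dw(w)`, Leibniz bound
  `norm_iteratedFDeriv_clm_apply`);
* the NEAR potential `Q₁[w] = Γ₀ * G[w]` (`Γ₀` the Newtonian kernel cut off at radius `2`,
  `∫|Γ₀| < ∞`) inherits `O((1+|x|)⁻⁶)`, and `∇Q₁ = Γ₀ * ∇G` (`fderiv_integral_smul_comp_sub_apply`);
* the FAR potential `Q₂[w](x) = ∫ D²Γ∞(x-y)(w y, w y) dy` and `∇Q₂ = ∫ D³Γ∞(x-y)(·, w y, w y)`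
  (`fderiv_farPotential_apply`) are `O((1+|x|)⁻²)`: the kernels decay like `(1+|z|)⁻³`
  (`exists_hasDecay_fderiv_newtonFar`), and Peetre's inequality
  `(1+|x-y|)⁻²(1+|y|)⁻² ≤ (1+|x|)⁻²` leaves the integrable `(1+|y|)⁻⁴`.

References: T. Tao, Anal. PDE 6 (2013), (35), (42), Lemma 4.1; D. Gilbarg, N. Trudinger,
Lemma 4.2; L. Brandolese, Math. Ann. 329 (2004) (the `|x|⁻³` pressure decay). All [folklore].
-/

noncomputable section

-- single-conjunct summit: `Summit.<Summit>.<Problem>` repeats the name by the D-0017 layout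
set_option linter.dupNamespace false

namespace Summit.NavierStokesRegularity.NavierStokesRegularity.Theorems.PlanarEnergyAPriori

open MeasureTheory Set Filter Topology Function Metric Real InnerProductSpace
open scoped ENNReal NNReal RealInnerProductSpace
open Literature.Analysis.FluidPDE

/-! ### The trace functional: `div f = τ(Df)`, `|τ L| ≤ 3 ‖L‖` -/

/-- **The divergence is a bounded linear functional of the derivative.** There is a continuous
linear `τ : (ℝ³ →L ℝ³) →L ℝ` (`L ↦ Σᵢ ⟪eᵢ, L eᵢ⟫`, the trace) with `div f (y) = τ (Df(y))` for
every field `f` and `|τ L| ≤ 3 ‖L‖`. [folklore] -/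
theorem exists_divergence_clm :
    ∃ τ : (EuclideanSpace ℝ (Fin 3) →L[ℝ] EuclideanSpace ℝ (Fin 3)) →L[ℝ] ℝ,
      (∀ (f : EuclideanSpace ℝ (Fin 3) → EuclideanSpace ℝ (Fin 3)) (y : EuclideanSpace ℝ (Fin 3)),
        VectorCalculus.divergence f y = τ (fderiv ℝ f y)) ∧
      ∀ L, ‖τ L‖ ≤ 3 * ‖L‖ := by
  set b := EuclideanSpace.basisFun (Fin 3) ℝ with hb
  set τ : (EuclideanSpace ℝ (Fin 3) →L[ℝ] EuclideanSpace ℝ (Fin 3)) →L[ℝ] ℝ :=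
    ∑ i : Fin 3, (innerSL ℝ (b i)).comp
      (ContinuousLinearMap.apply ℝ (EuclideanSpace ℝ (Fin 3)) (b i)) with hτ
  have hτL : ∀ L : EuclideanSpace ℝ (Fin 3) →L[ℝ] EuclideanSpace ℝ (Fin 3),
      τ L = ∑ i : Fin 3, ⟪b i, L (b i)⟫ := fun L => by
    simp only [hτ, FunLike.coe_sum, Finset.sum_apply, ContinuousLinearMap.comp_apply,
      ContinuousLinearMap.apply_apply, innerSL_apply_apply]
  refine ⟨τ, fun f y => ?_, fun L => ?_⟩
  · rw [hτL, divergence_eq_sum_inner_fderiv b]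
  · rw [hτL]
    have hbi : ∀ i, ‖b i‖ = 1 := fun i => b.orthonormal.1 i
    calc ‖∑ i : Fin 3, ⟪b i, L (b i)⟫‖ ≤ ∑ i : Fin 3, ‖⟪b i, L (b i)⟫‖ := norm_sum_le _ _
      _ ≤ ∑ _i : Fin 3, ‖L‖ := by
          refine Finset.sum_le_sum fun i _ => ?_
          calc ‖⟪b i, L (b i)⟫‖ ≤ ‖b i‖ * ‖L (b i)‖ := norm_inner_le_norm _ _
            _ ≤ ‖b i‖ * (‖L‖ * ‖b i‖) := by gcongr; exact L.le_opNorm _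
            _ = ‖L‖ := by rw [hbi i]; ring
      _ = 3 * ‖L‖ := by simp

/-! ### The convective term `(w·∇)w = Dw(w)`: first and second derivatives -/

/-- **Product rule for `(w·∇)w`**: `‖D((w·∇)w)(y)‖ ≤ ‖Dw(y)‖² + ‖D²w(y)‖ ‖w(y)‖` for
`w ∈ C²`. [folklore] -/
theorem norm_fderiv_convect_self_le {w : EuclideanSpace ℝ (Fin 3) → EuclideanSpace ℝ (Fin 3)}
    (hw : ContDiff ℝ 2 w) (y : EuclideanSpace ℝ (Fin 3)) :
    ‖fderiv ℝ (convect w w) y‖ ≤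
      ‖fderiv ℝ w y‖ ^ 2 + ‖fderiv ℝ (fderiv ℝ w) y‖ * ‖w y‖ := by
  have hc : HasFDerivAt (fderiv ℝ w) (fderiv ℝ (fderiv ℝ w) y) y :=
    ((hw.fderiv_right (m := 1) (by norm_num)).differentiable (by norm_num) y).hasFDerivAt
  have hu : HasFDerivAt w (fderiv ℝ w y) y := (hw.differentiable (by norm_num) y).hasFDerivAt
  have h := hc.clm_apply hu
  have hfun : (fun z => (fderiv ℝ w z) (w z)) = convect w w := rfl
  rw [hfun] at h
  rw [h.fderiv]
  calc ‖(fderiv ℝ w y).comp (fderiv ℝ w y) + (fderiv ℝ (fderiv ℝ w) y).flip (w y)‖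
      ≤ ‖(fderiv ℝ w y).comp (fderiv ℝ w y)‖ + ‖(fderiv ℝ (fderiv ℝ w) y).flip (w y)‖ :=
        norm_add_le _ _
    _ ≤ ‖fderiv ℝ w y‖ * ‖fderiv ℝ w y‖ + ‖(fderiv ℝ (fderiv ℝ w) y).flip‖ * ‖w y‖ :=
        add_le_add (ContinuousLinearMap.opNorm_comp_le _ _) (ContinuousLinearMap.le_opNorm _ _)
    _ = ‖fderiv ℝ w y‖ ^ 2 + ‖fderiv ℝ (fderiv ℝ w) y‖ * ‖w y‖ := by
        rw [ContinuousLinearMap.opNorm_flip, sq]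

/-- **Leibniz bound for the second derivative of `(w·∇)w`** (`w ∈ C³`):
`‖D²((w·∇)w)(y)‖ ≤ 3 ‖Dw‖ ‖D²w‖ + ‖D³w‖ ‖w‖` at `y`, all derivatives as `iteratedFDeriv` norms.
[folklore] -/
theorem norm_iteratedFDeriv_two_convect_self_le
    {w : EuclideanSpace ℝ (Fin 3) → EuclideanSpace ℝ (Fin 3)} (hw : ContDiff ℝ 3 w)
    (y : EuclideanSpace ℝ (Fin 3)) :
    ‖iteratedFDeriv ℝ 2 (convect w w) y‖ ≤
      3 * ‖iteratedFDeriv ℝ 1 w y‖ * ‖iteratedFDeriv ℝ 2 w y‖ +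
        ‖iteratedFDeriv ℝ 3 w y‖ * ‖iteratedFDeriv ℝ 0 w y‖ := by
  have hf : ContDiff ℝ 2 (fderiv ℝ w) := hw.fderiv_right (m := 2) (by norm_num)
  have hg : ContDiff ℝ 2 w := hw.of_le (by norm_num)
  have h := norm_iteratedFDeriv_clm_apply (f := fderiv ℝ w) (g := w) (n := 2) (N := 2) hf hg y
    le_rfl
  have hfun : (fun z => (fderiv ℝ w z) (w z)) = convect w w := rfl
  rw [hfun] at h
  refine h.trans (le_of_eq ?_)
  simp only [Finset.sum_range_succ, Finset.sum_range_zero, zero_add, norm_iteratedFDeriv_fderiv,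
    Nat.choose_zero_right, Nat.choose_one_right, Nat.choose_self, Nat.cast_one, one_mul,
    Nat.sub_zero, Nat.cast_ofNat]
  ring

/-! ### The source `G[w]` and its gradient under cubic decay -/

section Source

variable {w : EuclideanSpace ℝ (Fin 3) → EuclideanSpace ℝ (Fin 3)} {C : ℝ}

/-- From the weighted bounds `(1+|y|)³ ‖Dᵏw(y)‖ ≤ C` (`k ≤ 3`): `‖Dᵏw(y)‖ ≤ C ((1+|y|)³)⁻¹`.
[folklore] -/
theorem norm_iteratedFDeriv_le_of_weight
    (hk : ∀ k ≤ 3, ∀ y, (1 + ‖y‖) ^ 3 * ‖iteratedFDeriv ℝ k w y‖ ≤ C) {k : ℕ} (hk3 : k ≤ 3)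
    (y : EuclideanSpace ℝ (Fin 3)) : ‖iteratedFDeriv ℝ k w y‖ ≤ C * ((1 + ‖y‖) ^ 3)⁻¹ := by
  have hpos : 0 < (1 + ‖y‖) ^ 3 := by positivity
  rw [← div_eq_mul_inv, le_div_iff₀ hpos, mul_comm]
  exact hk k hk3 y

/-- A product of two weighted derivatives: `‖Dⁱw(y)‖ ‖Dʲw(y)‖ ≤ C² ((1+|y|)⁶)⁻¹` (`i, j ≤ 3`).
[folklore] -/
theorem norm_iteratedFDeriv_mul_le_of_weight (hC : 0 ≤ C)
    (hk : ∀ k ≤ 3, ∀ y, (1 + ‖y‖) ^ 3 * ‖iteratedFDeriv ℝ k w y‖ ≤ C) {i j : ℕ} (hi : i ≤ 3)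
    (hj : j ≤ 3) (y : EuclideanSpace ℝ (Fin 3)) :
    ‖iteratedFDeriv ℝ i w y‖ * ‖iteratedFDeriv ℝ j w y‖ ≤ C ^ 2 * ((1 + ‖y‖) ^ 6)⁻¹ := by
  have h1 := norm_iteratedFDeriv_le_of_weight hk hi y
  have h2 := norm_iteratedFDeriv_le_of_weight hk hj y
  have hw0 : 0 ≤ ((1 + ‖y‖) ^ 3)⁻¹ := by positivity
  calc ‖iteratedFDeriv ℝ i w y‖ * ‖iteratedFDeriv ℝ j w y‖
      ≤ (C * ((1 + ‖y‖) ^ 3)⁻¹) * (C * ((1 + ‖y‖) ^ 3)⁻¹) :=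
        mul_le_mul h1 h2 (norm_nonneg _) (mul_nonneg hC hw0)
    _ = C ^ 2 * ((1 + ‖y‖) ^ 6)⁻¹ := by
        have : (1 + ‖y‖) ^ 6 = (1 + ‖y‖) ^ 3 * (1 + ‖y‖) ^ 3 := by ring
        rw [this, mul_inv]; ring

/-- **The source is `O(C² (1+|y|)⁻⁶)`**: for a divergence-free `w ∈ C³` with the cubic weights,
`|G[w](y)| ≤ 6 C² ((1+|y|)⁶)⁻¹` (`G[w] = div((w·∇)w)`, `|div f| ≤ 3 ‖Df‖`,
`‖D((w·∇)w)‖ ≤ ‖Dw‖² + ‖D²w‖‖w‖`). [folklore] -/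
theorem abs_pressureSource_le_of_decay (hw : ContDiff ℝ 3 w) (hdiv : VectorCalculus.IsDivFree w)
    (hC : 0 ≤ C) (hk : ∀ k ≤ 3, ∀ y, (1 + ‖y‖) ^ 3 * ‖iteratedFDeriv ℝ k w y‖ ≤ C)
    (y : EuclideanSpace ℝ (Fin 3)) :
    |pressureSource w y| ≤ 6 * C ^ 2 * ((1 + ‖y‖) ^ 6)⁻¹ := by
  obtain ⟨τ, hτ, hτ3⟩ := exists_divergence_clm
  rw [pressureSource_eq_of_isDivFree hdiv, hτ, ← Real.norm_eq_abs]
  have hw2 : ContDiff ℝ 2 w := hw.of_le (by norm_num)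
  have h1 := norm_fderiv_convect_self_le hw2 y
  have hD1 : ‖fderiv ℝ w y‖ = ‖iteratedFDeriv ℝ 1 w y‖ := (norm_iteratedFDeriv_one w).symm
  have hD2 : ‖fderiv ℝ (fderiv ℝ w) y‖ = ‖iteratedFDeriv ℝ 2 w y‖ := by
    rw [← norm_iteratedFDeriv_zero (𝕜 := ℝ) (f := fderiv ℝ (fderiv ℝ w)), norm_iteratedFDeriv_fderiv,
      norm_iteratedFDeriv_fderiv]
  have hD0 : ‖w y‖ = ‖iteratedFDeriv ℝ 0 w y‖ := norm_iteratedFDeriv_zero.symm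
  have hp1 : ‖iteratedFDeriv ℝ 1 w y‖ * ‖iteratedFDeriv ℝ 1 w y‖ ≤ C ^ 2 * ((1 + ‖y‖) ^ 6)⁻¹ :=
    norm_iteratedFDeriv_mul_le_of_weight hC hk (by norm_num) (by norm_num) y
  have hp2 : ‖iteratedFDeriv ℝ 2 w y‖ * ‖iteratedFDeriv ℝ 0 w y‖ ≤ C ^ 2 * ((1 + ‖y‖) ^ 6)⁻¹ :=
    norm_iteratedFDeriv_mul_le_of_weight hC hk (by norm_num) (by norm_num) y
  calc ‖τ (fderiv ℝ (convect w w) y)‖ ≤ 3 * ‖fderiv ℝ (convect w w) y‖ := hτ3 _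
    _ ≤ 3 * (‖fderiv ℝ w y‖ ^ 2 + ‖fderiv ℝ (fderiv ℝ w) y‖ * ‖w y‖) := by gcongr
    _ = 3 * (‖iteratedFDeriv ℝ 1 w y‖ * ‖iteratedFDeriv ℝ 1 w y‖ +
          ‖iteratedFDeriv ℝ 2 w y‖ * ‖iteratedFDeriv ℝ 0 w y‖) := by rw [hD1, hD2, hD0, sq]
    _ ≤ 3 * (C ^ 2 * ((1 + ‖y‖) ^ 6)⁻¹ + C ^ 2 * ((1 + ‖y‖) ^ 6)⁻¹) := by gcongr
    _ = 6 * C ^ 2 * ((1 + ‖y‖) ^ 6)⁻¹ := by ring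

/-- **The gradient of the source is `O(C² (1+|y|)⁻⁶)`**: for a divergence-free `w ∈ C³` with the
cubic weights, `‖∇G[w](y)‖ ≤ 12 C² ((1+|y|)⁶)⁻¹` (`∇(div f) = τ ∘ D²f`, Leibniz). [folklore] -/
theorem norm_fderiv_pressureSource_le_of_decay (hw : ContDiff ℝ 3 w)
    (hdiv : VectorCalculus.IsDivFree w) (hC : 0 ≤ C)
    (hk : ∀ k ≤ 3, ∀ y, (1 + ‖y‖) ^ 3 * ‖iteratedFDeriv ℝ k w y‖ ≤ C)
    (y : EuclideanSpace ℝ (Fin 3)) :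
    ‖fderiv ℝ (pressureSource w) y‖ ≤ 12 * C ^ 2 * ((1 + ‖y‖) ^ 6)⁻¹ := by
  obtain ⟨τ, hτ, hτ3⟩ := exists_divergence_clm
  have hG : pressureSource w = ⇑τ ∘ fderiv ℝ (convect w w) := by
    rw [pressureSource_eq_of_isDivFree hdiv]; funext z; exact hτ _ z
  -- `(w·∇)w ∈ C²`, so `D((w·∇)w)` is differentiable
  have hconv : ContDiff ℝ 2 (convect w w) := by
    have : ContDiff ℝ 2 fun z => (fderiv ℝ w z) (w z) :=
      (hw.fderiv_right (m := 2) (by norm_num)).clm_apply (hw.of_le (by norm_num))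
    exact this
  have hΦ : HasFDerivAt (fderiv ℝ (convect w w)) (fderiv ℝ (fderiv ℝ (convect w w)) y) y :=
    ((hconv.fderiv_right (m := 1) (by norm_num)).differentiable (by norm_num) y).hasFDerivAt
  have hcomp := τ.hasFDerivAt.comp y hΦ
  rw [hG, hcomp.fderiv]
  have hD2 : ‖fderiv ℝ (fderiv ℝ (convect w w)) y‖ = ‖iteratedFDeriv ℝ 2 (convect w w) y‖ := by
    rw [← norm_iteratedFDeriv_zero (𝕜 := ℝ) (f := fderiv ℝ (fderiv ℝ (convect w w))),
      norm_iteratedFDeriv_fderiv, norm_iteratedFDeriv_fderiv]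
  have hτnorm : ‖τ‖ ≤ 3 := ContinuousLinearMap.opNorm_le_bound _ (by norm_num) hτ3
  have hp12 : ‖iteratedFDeriv ℝ 1 w y‖ * ‖iteratedFDeriv ℝ 2 w y‖ ≤ C ^ 2 * ((1 + ‖y‖) ^ 6)⁻¹ :=
    norm_iteratedFDeriv_mul_le_of_weight hC hk (by norm_num) (by norm_num) y
  have hp30 : ‖iteratedFDeriv ℝ 3 w y‖ * ‖iteratedFDeriv ℝ 0 w y‖ ≤ C ^ 2 * ((1 + ‖y‖) ^ 6)⁻¹ :=
    norm_iteratedFDeriv_mul_le_of_weight hC hk (by norm_num) (by norm_num) y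
  calc ‖τ.comp (fderiv ℝ (fderiv ℝ (convect w w)) y)‖
      ≤ ‖τ‖ * ‖fderiv ℝ (fderiv ℝ (convect w w)) y‖ := ContinuousLinearMap.opNorm_comp_le _ _
    _ ≤ 3 * ‖iteratedFDeriv ℝ 2 (convect w w) y‖ := by rw [hD2]; gcongr
    _ ≤ 3 * (3 * ‖iteratedFDeriv ℝ 1 w y‖ * ‖iteratedFDeriv ℝ 2 w y‖ +
          ‖iteratedFDeriv ℝ 3 w y‖ * ‖iteratedFDeriv ℝ 0 w y‖) := by
        gcongr; exact norm_iteratedFDeriv_two_convect_self_le hw y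
    _ = 3 * (3 * (‖iteratedFDeriv ℝ 1 w y‖ * ‖iteratedFDeriv ℝ 2 w y‖) +
          ‖iteratedFDeriv ℝ 3 w y‖ * ‖iteratedFDeriv ℝ 0 w y‖) := by ring
    _ ≤ 3 * (3 * (C ^ 2 * ((1 + ‖y‖) ^ 6)⁻¹) + C ^ 2 * ((1 + ‖y‖) ^ 6)⁻¹) := by gcongr
    _ = 12 * C ^ 2 * ((1 + ‖y‖) ^ 6)⁻¹ := by ring

end Source

/-! ### Weight algebra -/

/-- Near shifts: for `‖z‖ ≤ 2`, `((1+‖x-z‖)⁶)⁻¹ ≤ 729 ((1+‖x‖)⁶)⁻¹`. [folklore] -/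
theorem inv_one_add_norm_sub_pow_six_le {x z : EuclideanSpace ℝ (Fin 3)} (hz : ‖z‖ ≤ 2) :
    ((1 + ‖x - z‖) ^ 6)⁻¹ ≤ 729 * ((1 + ‖x‖) ^ 6)⁻¹ := by
  have hpos : 0 < (1 + ‖x - z‖) ^ 6 := by positivity
  have hpos' : 0 < (1 + ‖x‖) ^ 6 := by positivity
  rw [← div_eq_mul_inv, le_div_iff₀ hpos', inv_mul_le_iff₀ hpos]
  have h1 : 1 + ‖x‖ ≤ 3 * (1 + ‖x - z‖) := by
    have := norm_le_norm_sub_add x z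
    linarith [norm_nonneg (x - z)]
  calc (1 + ‖x‖) ^ 6 ≤ (3 * (1 + ‖x - z‖)) ^ 6 := pow_le_pow_left₀ (by positivity) h1 6
    _ = (1 + ‖x - z‖) ^ 6 * 729 := by ring

/-- Peetre with the far kernel: `((1+‖x-y‖)³)⁻¹ ((1+‖y‖)⁶)⁻¹ ≤ ((1+‖x‖)²)⁻¹ ((1+‖y‖)⁴)⁻¹`
(`1 + ‖x‖ ≤ (1 + ‖x-y‖)(1 + ‖y‖)`). [folklore] -/
theorem far_weight_le (x y : EuclideanSpace ℝ (Fin 3)) :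
    ((1 + ‖x - y‖) ^ 3)⁻¹ * ((1 + ‖y‖) ^ 6)⁻¹ ≤ ((1 + ‖x‖) ^ 2)⁻¹ * ((1 + ‖y‖) ^ 4)⁻¹ := by
  have ha : 0 < 1 + ‖x - y‖ := by positivity
  have hb : 0 < 1 + ‖y‖ := by positivity
  have hc : 0 < 1 + ‖x‖ := by positivity
  have hpeetre : 1 + ‖x‖ ≤ (1 + ‖x - y‖) * (1 + ‖y‖) := by
    have := norm_le_norm_sub_add x y
    nlinarith [norm_nonneg (x - y), norm_nonneg y]
  have h1 : ((1 + ‖x - y‖) ^ 3)⁻¹ ≤ ((1 + ‖x - y‖) ^ 2)⁻¹ :=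
    inv_anti₀ (by positivity) (pow_le_pow_right₀ (by linarith [norm_nonneg (x - y)]) (by norm_num))
  have h2 : ((1 + ‖x - y‖) ^ 2)⁻¹ * ((1 + ‖y‖) ^ 2)⁻¹ ≤ ((1 + ‖x‖) ^ 2)⁻¹ := by
    rw [← mul_inv, ← mul_pow]
    exact inv_anti₀ (by positivity) (pow_le_pow_left₀ hc.le hpeetre 2)
  calc ((1 + ‖x - y‖) ^ 3)⁻¹ * ((1 + ‖y‖) ^ 6)⁻¹
      ≤ ((1 + ‖x - y‖) ^ 2)⁻¹ * ((1 + ‖y‖) ^ 6)⁻¹ := by gcongr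
    _ = (((1 + ‖x - y‖) ^ 2)⁻¹ * ((1 + ‖y‖) ^ 2)⁻¹) * ((1 + ‖y‖) ^ 4)⁻¹ := by
        rw [show (1 + ‖y‖) ^ 6 = (1 + ‖y‖) ^ 2 * (1 + ‖y‖) ^ 4 by ring, mul_inv]; ring
    _ ≤ ((1 + ‖x‖) ^ 2)⁻¹ * ((1 + ‖y‖) ^ 4)⁻¹ := by gcongr

/-- **The source of the pressure Poisson equation and its gradient under cubic decay
(registered form).** For a divergence-free `w ∈ C³(ℝ³; ℝ³)` with `(1+|y|)³ ‖Dᵏw(y)‖ ≤ C`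
(`k ≤ 3`, `C ≥ 0`): `|G[w](y)| ≤ 6 C² ((1+|y|)⁶)⁻¹` and `‖∇G[w](y)‖ ≤ 12 C² ((1+|y|)⁶)⁻¹`,
`G[w] = ∂ᵢ∂ⱼ(wᵢwⱼ)` (`pressureSource`). [folklore] -/
theorem pressureSource_decay_of_weight :
    ∀ (w : EuclideanSpace ℝ (Fin 3) → EuclideanSpace ℝ (Fin 3)) (C : ℝ), 0 ≤ C → ContDiff ℝ 3 w →
      Literature.Analysis.FluidPDE.VectorCalculus.IsDivFree w →
      (∀ k ≤ 3, ∀ y, (1 + ‖y‖) ^ 3 * ‖iteratedFDeriv ℝ k w y‖ ≤ C) →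
      ∀ y, |Literature.Analysis.FluidPDE.pressureSource w y| ≤ 6 * C ^ 2 * ((1 + ‖y‖) ^ 6)⁻¹ ∧
        ‖fderiv ℝ (Literature.Analysis.FluidPDE.pressureSource w) y‖ ≤
          12 * C ^ 2 * ((1 + ‖y‖) ^ 6)⁻¹ :=
  fun _ _ hC hw hdiv hk y =>
    ⟨abs_pressureSource_le_of_decay hw hdiv hC hk y, norm_fderiv_pressureSource_le_of_decay hw hdiv hC hk y⟩

end Summit.NavierStokesRegularity.NavierStokesRegularity.Theorems.PlanarEnergyAPriori

end
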